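import Literature.AlgebraicGeometry.AbelianSchemes.LevelStructureOfIsogeny
import Literature.AlgebraicGeometry.AbelianSchemes.FibreHomPointsOfFibrePoints
import Literature.AlgebraicGeometry.AbelianSchemes.AbelianSchemeOverQuasiInverseIsogeny
import Literature.AlgebraicGeometry.AbelianSchemes.SerreTensorIdealTranslationQuasiInverse
import Literature.AlgebraicGeometry.Motives.AlgPointsMapSurjectiveAlgClosed
import HarnessLib

/-!
# Level structures along a quasi-inverse pair of isogenies of degree prime to the level, and the level structure of a
# Serre twist `A ⊗_𝒪 𝔟` ([MumfordAV1970] §7 Thm. 4; [MumfordFogartyKirwan1994] Def. 7.1; [RapoportSmithlingZhang2020Diagonal] §3.2, §4.3)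

Topic `AlgebraicGeometry/AbelianSchemes`, namespace `Literature.AlgebraicGeometry.AbelianSchemes.AbelianSchemeOver`.
THEOREMS ONLY (no definition, no named fact, no `instance`, no notation, no `sorry`); ANY base scheme `S`.
Cell `hodgecm-mathlib`, F0/P6 «MOD», organ deal (O-γ) «SERRE TWIST OF A PEL FAMILY», part (γ3) «LEVEL TRANSPORT» (desk F0P6a-plan (g1)
2026-09-01T18:10:45Z; lead hand A-p06 (g30), twins A-p01 (g24), F0P6-p16 (g0)); companion of ★ `SerreTwistPolarization` (γ2).
`--supports stmt-HodgeConjecture-24832`, count-neutral: HC_CM is proved only modulo the 2 remaining named inputs (hLiu418, h413) until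
rung 0 closes; this file discharges none of them.

## Mathematics

§1–§2 (generic).  Let `φ : A → B`, `ψ : B → A` be homomorphisms of abelian schemes over `S` with `φ ≫ ψ = [N]_A` and
`ψ ≫ φ = [N]_B`, `N ≠ 0` (a QUASI-INVERSE PAIR, ★ `AbelianSchemeOverQuasiInverseIsogeny`).  Then on every geometric fibre `φ_s` is an
isogeny (★ `isIsogeny_fibreHom_of_quasiInverse`), hence ONTO on `Ω`-points (★ `AlgPoints.map_surjective_of_surjective_of_isAlgClosed`,
read in the `FibrePoints` currency through ★ `FibreHomPointsOfFibrePoints`), and its kernel is killed by `N` (`x ≫ φ = 1 ⟹ x ^ N =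
x ≫ φ ≫ ψ = 1`).  So for `Nat.Coprime N n` [MumfordAV1970, §7 Thm. 4] makes `φ` BIJECTIVE on `n`-torsion of geometric fibres, and a
level-`n` structure `lvl` on `A/S` induces a UNIQUE level-`n` structure `lvl′` on `B/S` with `lvl′.σ i = lvl.σ i ≫ φ`
(★ `LevelStructure.existsUnique_comp_of_torsionBijOn`, [MumfordFogartyKirwan1994, Def. 7.1]); transporting back along `ψ` gives the
sections `lvl.σ i ^ N` (`= lvl.σ i ≫ [N]`).

§3 (the Serre twist).  For a ring action `act : 𝒪 → End_S(A)` on the commutative abelian scheme `A/S`, a presented f.g. projective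
module `𝔟 = E′·𝒪ᵐ` (`E′² = E′`) with an element `P ∈ 𝔟` (`E′P = P`) and a quasi-inverse row `Q` (`QE′ = Q`, `QP = N`, `PQ = N·E′`,
`N ≠ 0`; MODEL CASE `𝔟 = 𝔞⁻¹ ∋ 1 = P` for an ideal `𝔞` of a Dedekind ring with `N ∈ 𝔞`), the ideal translation
`ψ_P : A → A ⊗_𝒪 𝔟` (★ `serreTranslate`) and `ψ′ : A ⊗_𝒪 𝔟 → A` (★ `serreTranslateInv`) are such a pair (★
`serreTranslate_comp_serreTranslateInv`, ★ `serreTranslateInv_comp_serreTranslate`).  Hence for a level `n` PRIME TO `N` (RSZ: the level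
is prime to `𝔞`) a level-`n` structure on `A` induces a unique one on the Serre twist `A ⊗_𝒪 𝔟` along `ψ_P`
(`LevelStructure.existsUnique_serreTwist`), and conversely along `ψ′` (`LevelStructure.existsUnique_serreUntwist`); this is the level
component of the Serre-twisted tuple `(A ⊗ 𝔞⁻¹, ι, λ, η)` of [RapoportSmithlingZhang2020Diagonal, §3.2 / (4.23)] (there for prime-to-`p`
level `K^p`-orbits `η̄`; here in the tree's full-level-`n` currency `LevelStructure g n`).

## Contents

* §1 `exists_fibrePoints_comp_eq_of_surjective_fibreHom`, `exists_fibrePoints_comp_eq_of_isIsogeny_fibreHom` (onto on geometric fibre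
  points from «`u_s` surjective ∕ an isogeny», bare homomorphism `u : A → B`), `exists_fibrePoints_comp_eq_of_quasiInverse`,
  `pow_eq_one_of_comp_eq_one_of_comp_eq_pow_id` (kernel killed by `N`);
* §2 `LevelStructure.existsUnique_comp_of_quasiInverse`, `LevelStructure.exists_comp_of_quasiInverse`, `LevelStructure.σ_comp_eq_pow_of_σ_eq_comp`
  (back-transport reads `σᵢ ^ N`);
* §3 `exists_fibrePoints_comp_serreTranslate_eq`, `pow_eq_one_of_comp_serreTranslate_eq_one`, `exists_fibrePoints_comp_serreTranslateInv_eq`,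
  `pow_eq_one_of_comp_serreTranslateInv_eq_one`, **`LevelStructure.existsUnique_serreTwist`**, **`LevelStructure.existsUnique_serreUntwist`**,
  `LevelStructure.σ_comp_serreTranslateInv_of_σ_eq_comp_serreTranslate`.

## References
* [MumfordAV1970] D. Mumford, *Abelian Varieties* (1970), §7 Thm. 4 (p. 72).
* [MumfordFogartyKirwan1994] D. Mumford, J. Fogarty, F. Kirwan, *Geometric Invariant Theory*, 3rd ed. (1994), Ch. 7 §1 Def. 7.1 (p. 129).
* [RapoportSmithlingZhang2020Diagonal] M. Rapoport, B. Smithling, W. Zhang, *Arithmetic diagonal cycles on unitary Shimura varieties*,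
  Compositio Math. 156 (2020), §3.2 and §4.3, (4.23) (Serre twist of the moduli tuple).
* [Conrad2004GrossZagier] B. Conrad, *Gross–Zagier revisited*, MSRI Publ. 49 (2004), §7 Thm. 7.5 (the Serre tensor construction).
* [GortzWedhorn2020] U. Görtz, T. Wedhorn, *Algebraic Geometry I*, 2nd ed. (2020), Cor. 3.36 (p. 83), (4.7.1) (p. 108).
* Tree: ★ `LevelStructureOfIsogeny`, ★ `FibreHomPointsOfFibrePoints`, ★ `AbelianSchemeOverQuasiInverseIsogeny`,
  ★ `SerreTensorIdealTranslationQuasiInverse`, ★ `Motives/AlgPointsMapSurjectiveAlgClosed`.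
-/

noncomputable section

universe u

open CategoryTheory CategoryTheory.Limits AlgebraicGeometry MonoidalCategory CartesianMonoidalCategory
open scoped MonObj

namespace Literature.AlgebraicGeometry.AbelianSchemes

namespace AbelianSchemeOver

open Literature.AlgebraicGeometry.Motives

variable {S : Scheme.{u}} {A B : AbelianSchemeOver S}

/-! ### §1 Onto on geometric fibre points; the kernel of a quasi-invertible homomorphism is killed by `N` -/

/-- **A homomorphism `u : A → B` whose fibre `u_s` is SURJECTIVE is onto on `Ω`-points of the geometric fibre** (`FibrePoints` currency:
every `y : B.FibrePoints s` is `x ≫ u`) — `u_s` is locally of finite type and surjective, so `Ω`-points lift (★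
`AlgPoints.map_surjective_of_surjective_of_isAlgClosed`, [GortzWedhorn2020] Cor. 3.36), read through the partner dictionary ★
`FibreHomPointsOfFibrePoints`.  (The bare-homomorphism form of ★ `IsLambdaOfAt.exists_comp_eq_of_isAmple_of_dim_eq` ∕ ★
`Polarization.exists_comp_lam_eq_of_dim_hat`.) [cite: GortzWedhorn2020, Cor. 3.36 (p. 83) and Section (4.7), (4.7.1) (p. 108)]
[cite: MumfordAV1970, §7 Thm. 4 (p. 72)] -/
theorem exists_fibrePoints_comp_eq_of_surjective_fibreHom (u : A.X ⟶ B.X) [IsMonHom u] {Ω : Type u} [Field Ω] [IsAlgClosed Ω]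
    (s : Spec (.of Ω) ⟶ S) (hs : Surjective (AbelianVariety.Hom.toSchemeHom (fibreHom u s))) (y : B.FibrePoints s) :
    ∃ x : A.FibrePoints s, x ≫ u = y := by
  haveI : Surjective (fibreHom u s).hom.hom.hom.left := hs
  obtain ⟨Q, hQ⟩ := B.exists_points_fibrePointToLeft_eq s y
  obtain ⟨P, hP⟩ := AlgPoints.map_surjective_of_surjective_of_isAlgClosed (L := Ω) (fibreHom u s).hom.hom.hom Q
  obtain ⟨x, hx⟩ := A.exists_fibrePoints_fibrePointToLeft_eq s P
  refine ⟨x, B.fibrePoints_eq_of_fibrePointToLeft_eq s (P := Q) ?_ hQ⟩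
  rw [← hP]
  exact fibrePointToLeft_map_fibreHom_eq_comp_left s u hx

/-- **A homomorphism which is an ISOGENY on the geometric fibre at `s` is onto on its `Ω`-points** (`FibrePoints` currency).
[cite: MumfordAV1970, §7 Thm. 4 (p. 72)] [cite: GortzWedhorn2020, Cor. 3.36 (p. 83)] -/
theorem exists_fibrePoints_comp_eq_of_isIsogeny_fibreHom (u : A.X ⟶ B.X) [IsMonHom u] {Ω : Type u} [Field Ω] [IsAlgClosed Ω]
    (s : Spec (.of Ω) ⟶ S) (hs : AbelianVariety.IsIsogeny (fibreHom u s)) (y : B.FibrePoints s) :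
    ∃ x : A.FibrePoints s, x ≫ u = y :=
  exists_fibrePoints_comp_eq_of_surjective_fibreHom u s hs.1 y

variable (φ : A.X ⟶ B.X) (ψ : B.X ⟶ A.X) {N : ℕ}

/-- **A quasi-invertible homomorphism is onto on geometric fibre points**: if `φ ≫ ψ = [N]_A`, `ψ ≫ φ = [N]_B`, `N ≠ 0`, then every
`y : B.FibrePoints s` is `x ≫ φ` (★ `isIsogeny_fibreHom_of_quasiInverse`) — the `hsurj` binder of ★ `exists_pow_eq_one_and_comp_eq` ∕ ★
`LevelStructure.exists_comp_changeLevel_of_coprime`. [cite: MumfordAV1970, §7 Thm. 4 (p. 72)] [cite: GortzWedhorn2020, Cor. 3.36 (p. 83)] -/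
theorem exists_fibrePoints_comp_eq_of_quasiInverse [IsMonHom φ] (hN : N ≠ 0) (hφψ : φ ≫ ψ = (𝟙 A.X) ^ N)
    (hψφ : ψ ≫ φ = (𝟙 B.X) ^ N) ⦃Ω : Type u⦄ [Field Ω] [IsAlgClosed Ω] (s : Spec (.of Ω) ⟶ S) (y : B.FibrePoints s) :
    ∃ x : A.FibrePoints s, x ≫ φ = y :=
  exists_fibrePoints_comp_eq_of_isIsogeny_fibreHom φ s (isIsogeny_fibreHom_of_quasiInverse φ ψ hN hφψ hψφ s) y

/-- **The kernel of `φ` is killed by `N`** when `φ ≫ ψ = [N]`: `x ≫ φ = 1 ⟹ x ^ N = x ≫ φ ≫ ψ = 1` (on `T`-valued points, any `T`) —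
the `hker` binder of ★ `eq_one_of_pow_eq_one_of_comp_eq_one` ∕ ★ `exists_pow_eq_one_and_comp_eq`. [cite: MumfordAV1970, §7 Thm. 4 (p. 72)] -/
theorem pow_eq_one_of_comp_eq_one_of_comp_eq_pow_id [IsMonHom ψ] (hφψ : φ ≫ ψ = (𝟙 A.X) ^ N) {T : Over S} (x : T ⟶ A.X)
    (hx : x ≫ φ = 1) : x ^ N = 1 := by
  have h : x ≫ φ ≫ ψ = 1 := by rw [← Category.assoc, hx, MonObj.one_comp]
  rwa [hφψ, MonObj.comp_pow, Category.comp_id] at h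

/-! ### §2 Level transport along a quasi-inverse pair of degree prime to the level -/

namespace LevelStructure

variable {g n : ℕ}

/-- **LEVEL TRANSPORT ALONG AN ISOGENY OF DEGREE PRIME TO THE LEVEL** ([MumfordAV1970, §7 Thm. 4] + [MumfordFogartyKirwan1994, Def. 7.1]):
for a quasi-inverse pair `φ ≫ ψ = [N]_A`, `ψ ≫ φ = [N]_B` (`N ≠ 0`) and `Nat.Coprime N n`, a level-`n` structure `lvl` on `A/S` induces a
UNIQUE level-`n` structure `lvl′` on `B/S` with `lvl′.σ i = lvl.σ i ≫ φ` (★ `existsUnique_comp_of_torsionBijOn` with §1).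
[cite: MumfordAV1970, §7 Thm. 4 (p. 72)] [cite: MumfordFogartyKirwan1994, Ch. 7 §1 Definition 7.1 (p. 129)] -/
theorem existsUnique_comp_of_quasiInverse (lvl : A.LevelStructure g n) (φ : A.X ⟶ B.X) (ψ : B.X ⟶ A.X) [IsMonHom φ] [IsMonHom ψ]
    (hN : N ≠ 0) (hφψ : φ ≫ ψ = (𝟙 A.X) ^ N) (hψφ : ψ ≫ φ = (𝟙 B.X) ^ N) (hcop : Nat.Coprime N n) :
    ∃! lvl' : B.LevelStructure g n, ∀ i, lvl'.σ i = lvl.σ i ≫ φ :=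
  lvl.existsUnique_comp_of_torsionBijOn φ
    (eq_one_of_pow_eq_one_of_comp_eq_one φ hcop fun _ _ _ _ x hx =>
      pow_eq_one_of_comp_eq_one_of_comp_eq_pow_id φ ψ hφψ x hx)
    (exists_pow_eq_one_and_comp_eq φ hcop (exists_fibrePoints_comp_eq_of_quasiInverse φ ψ hN hφψ hψφ) fun _ _ _ _ x hx =>
      pow_eq_one_of_comp_eq_one_of_comp_eq_pow_id φ ψ hφψ x hx)

/-- Existence alone. [cite: MumfordAV1970, §7 Thm. 4 (p. 72)] [cite: MumfordFogartyKirwan1994, Ch. 7 §1 Definition 7.1 (p. 129)] -/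
theorem exists_comp_of_quasiInverse (lvl : A.LevelStructure g n) (φ : A.X ⟶ B.X) (ψ : B.X ⟶ A.X) [IsMonHom φ] [IsMonHom ψ]
    (hN : N ≠ 0) (hφψ : φ ≫ ψ = (𝟙 A.X) ^ N) (hψφ : ψ ≫ φ = (𝟙 B.X) ^ N) (hcop : Nat.Coprime N n) :
    ∃ lvl' : B.LevelStructure g n, ∀ i, lvl'.σ i = lvl.σ i ≫ φ :=
  (lvl.existsUnique_comp_of_quasiInverse φ ψ hN hφψ hψφ hcop).exists

/-- **Transport back reads `σᵢ ^ N`**: if `lvl′.σ i = lvl.σ i ≫ φ` and `φ ≫ ψ = [N]_A` then `lvl′.σ i ≫ ψ = lvl.σ i ^ N` — so the round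
trip `A → B → A` returns `lvl` precomposed with the automorphism `[N]` of `A[n]` (`(N, n) = 1`), not `lvl` itself.
[cite: MumfordAV1970, §7 Thm. 4 (p. 72)] [cite: MumfordFogartyKirwan1994, App. 7A (p. 235)] -/
theorem σ_comp_eq_pow_of_σ_eq_comp {lvl : A.LevelStructure g n} {lvl' : B.LevelStructure g n} {φ : A.X ⟶ B.X} {ψ : B.X ⟶ A.X}
    (h : ∀ i, lvl'.σ i = lvl.σ i ≫ φ) (hφψ : φ ≫ ψ = (𝟙 A.X) ^ N) (i : Fin g ⊕ Fin g) :
    lvl'.σ i ≫ ψ = lvl.σ i ^ N := by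
  rw [h i, Category.assoc, hφψ, MonObj.comp_pow, Category.comp_id]

end LevelStructure

/-! ### §3 The Serre twist `A ⊗_𝒪 𝔟` along the ideal translation `ψ_P` and its quasi-inverse `ψ′` -/

section Serre

variable {O : Type*} [CommRing O] (act : A.RingAction O) [IsCommMonObj A.X] {m : ℕ} (E' : Matrix (Fin m) (Fin m) O)
  (hE' : E' * E' = E') (P : Matrix (Fin m) (Fin 1) O) (Q : Matrix (Fin 1) (Fin m) O) {N : ℕ}

/-- **`ψ_P : A → A ⊗_𝒪 𝔟` is onto on geometric fibre points** (quasi-inverse `ψ′`, `N ≠ 0`).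
[cite: Conrad2004GrossZagier, §7 (Thm. 7.5)] [cite: MumfordAV1970, §7 Thm. 4 (p. 72)] -/
theorem exists_fibrePoints_comp_serreTranslate_eq (hN : N ≠ 0) (hP : E' * P = P) (hQ : Q * E' = Q)
    (hQP : Q * P = Matrix.scalar (Fin 1) (N : O)) (hPQ : P * Q = Matrix.scalar (Fin m) (N : O) * E')
    ⦃Ω : Type u⦄ [Field Ω] [IsAlgClosed Ω] (s : Spec (.of Ω) ⟶ S) (y : (serreTensor act E' hE').FibrePoints s) :
    ∃ x : A.FibrePoints s, x ≫ serreTranslate act E' hE' P = y :=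
  haveI := isMonHom_serreTranslate act E' hE' P
  exists_fibrePoints_comp_eq_of_quasiInverse (serreTranslate act E' hE' P) (serreTranslateInv act E' hE' Q) hN
    (serreTranslate_comp_serreTranslateInv act E' hE' P Q hP hQ hQP) (serreTranslateInv_comp_serreTranslate act E' hE' P Q hP hQ hPQ) s y

/-- **The kernel of `ψ_P` is killed by `N`** (`N ∈ 𝔞` in the model case `Ker ψ_P = A[𝔞]`): `x ≫ ψ_P = 1 ⟹ x ^ N = 1`.
[cite: Conrad2004GrossZagier, §7 (Thm. 7.5)] [cite: MumfordAV1970, §7 Thm. 4 (p. 72)] -/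
theorem pow_eq_one_of_comp_serreTranslate_eq_one (hP : E' * P = P) (hQ : Q * E' = Q) (hQP : Q * P = Matrix.scalar (Fin 1) (N : O))
    {T : Over S} (x : T ⟶ A.X) (hx : x ≫ serreTranslate act E' hE' P = 1) : x ^ N = 1 :=
  haveI := isMonHom_serreTranslateInv act E' hE' Q
  pow_eq_one_of_comp_eq_one_of_comp_eq_pow_id (serreTranslate act E' hE' P) (serreTranslateInv act E' hE' Q)
    (serreTranslate_comp_serreTranslateInv act E' hE' P Q hP hQ hQP) x hx

/-- **`ψ′ : A ⊗_𝒪 𝔟 → A` is onto on geometric fibre points.** [cite: Conrad2004GrossZagier, §7 (Thm. 7.5)] [cite: MumfordAV1970, §7 Thm. 4 (p. 72)] -/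
theorem exists_fibrePoints_comp_serreTranslateInv_eq (hN : N ≠ 0) (hP : E' * P = P) (hQ : Q * E' = Q)
    (hQP : Q * P = Matrix.scalar (Fin 1) (N : O)) (hPQ : P * Q = Matrix.scalar (Fin m) (N : O) * E')
    ⦃Ω : Type u⦄ [Field Ω] [IsAlgClosed Ω] (s : Spec (.of Ω) ⟶ S) (y : A.FibrePoints s) :
    ∃ x : (serreTensor act E' hE').FibrePoints s, x ≫ serreTranslateInv act E' hE' Q = y :=
  haveI := isMonHom_serreTranslateInv act E' hE' Q
  exists_fibrePoints_comp_eq_of_quasiInverse (serreTranslateInv act E' hE' Q) (serreTranslate act E' hE' P) hN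
    (serreTranslateInv_comp_serreTranslate act E' hE' P Q hP hQ hPQ) (serreTranslate_comp_serreTranslateInv act E' hE' P Q hP hQ hQP) s y

/-- **The kernel of `ψ′` is killed by `N`.** [cite: Conrad2004GrossZagier, §7 (Thm. 7.5)] [cite: MumfordAV1970, §7 Thm. 4 (p. 72)] -/
theorem pow_eq_one_of_comp_serreTranslateInv_eq_one (hP : E' * P = P) (hQ : Q * E' = Q)
    (hPQ : P * Q = Matrix.scalar (Fin m) (N : O) * E') {T : Over S} (x : T ⟶ (serreTensor act E' hE').X)
    (hx : x ≫ serreTranslateInv act E' hE' Q = 1) : x ^ N = 1 :=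
  haveI := isMonHom_serreTranslate act E' hE' P
  pow_eq_one_of_comp_eq_one_of_comp_eq_pow_id (serreTranslateInv act E' hE' Q) (serreTranslate act E' hE' P)
    (serreTranslateInv_comp_serreTranslate act E' hE' P Q hP hQ hPQ) x hx

/-- **THE LEVEL STRUCTURE OF THE SERRE TWIST** ([RapoportSmithlingZhang2020Diagonal] §3.2 ∕ (4.23), level component; [MumfordAV1970] §7
Thm. 4): for a level `n` PRIME TO `N` (`N ∈ 𝔞`: the level is prime to `𝔞`), a level-`n` structure `lvl` on `A/S` induces a UNIQUE
level-`n` structure `lvl′` on `A ⊗_𝒪 𝔟` with `lvl′.σ i = lvl.σ i ≫ ψ_P`.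
[cite: RapoportSmithlingZhang2020Diagonal, §3.2 and (4.23)] [cite: MumfordAV1970, §7 Thm. 4 (p. 72)]
[cite: MumfordFogartyKirwan1994, Ch. 7 §1 Definition 7.1 (p. 129)] -/
theorem LevelStructure.existsUnique_serreTwist {g n : ℕ} (lvl : A.LevelStructure g n) (hN : N ≠ 0) (hP : E' * P = P)
    (hQ : Q * E' = Q) (hQP : Q * P = Matrix.scalar (Fin 1) (N : O)) (hPQ : P * Q = Matrix.scalar (Fin m) (N : O) * E')
    (hcop : Nat.Coprime N n) :
    ∃! lvl' : (serreTensor act E' hE').LevelStructure g n, ∀ i, lvl'.σ i = lvl.σ i ≫ serreTranslate act E' hE' P :=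
  haveI := isMonHom_serreTranslate act E' hE' P
  haveI := isMonHom_serreTranslateInv act E' hE' Q
  lvl.existsUnique_comp_of_quasiInverse (serreTranslate act E' hE' P) (serreTranslateInv act E' hE' Q) hN
    (serreTranslate_comp_serreTranslateInv act E' hE' P Q hP hQ hQP) (serreTranslateInv_comp_serreTranslate act E' hE' P Q hP hQ hPQ) hcop

/-- **… and of the UNTWIST**: a level-`n` structure `lvl′` on `A ⊗_𝒪 𝔟` induces a unique one on `A` along `ψ′` (`(N, n) = 1`).
[cite: RapoportSmithlingZhang2020Diagonal, §3.2 and (4.23)] [cite: MumfordAV1970, §7 Thm. 4 (p. 72)]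
[cite: MumfordFogartyKirwan1994, Ch. 7 §1 Definition 7.1 (p. 129)] -/
theorem LevelStructure.existsUnique_serreUntwist {g n : ℕ} (lvl' : (serreTensor act E' hE').LevelStructure g n) (hN : N ≠ 0)
    (hP : E' * P = P) (hQ : Q * E' = Q) (hQP : Q * P = Matrix.scalar (Fin 1) (N : O))
    (hPQ : P * Q = Matrix.scalar (Fin m) (N : O) * E') (hcop : Nat.Coprime N n) :
    ∃! lvl : A.LevelStructure g n, ∀ i, lvl.σ i = lvl'.σ i ≫ serreTranslateInv act E' hE' Q :=
  haveI := isMonHom_serreTranslate act E' hE' P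
  haveI := isMonHom_serreTranslateInv act E' hE' Q
  lvl'.existsUnique_comp_of_quasiInverse (serreTranslateInv act E' hE' Q) (serreTranslate act E' hE' P) hN
    (serreTranslateInv_comp_serreTranslate act E' hE' P Q hP hQ hPQ) (serreTranslate_comp_serreTranslateInv act E' hE' P Q hP hQ hQP) hcop

/-- **Round trip**: if `lvl′.σ i = lvl.σ i ≫ ψ_P` then `lvl′.σ i ≫ ψ′ = lvl.σ i ^ N` (`ψ_P ≫ ψ′ = [N]`).
[cite: Conrad2004GrossZagier, §7 (Thm. 7.5)] [cite: MumfordAV1970, §7 Thm. 4 (p. 72)] -/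
theorem LevelStructure.σ_comp_serreTranslateInv_of_σ_eq_comp_serreTranslate {g n : ℕ} {lvl : A.LevelStructure g n}
    {lvl' : (serreTensor act E' hE').LevelStructure g n} (h : ∀ i, lvl'.σ i = lvl.σ i ≫ serreTranslate act E' hE' P)
    (hP : E' * P = P) (hQ : Q * E' = Q) (hQP : Q * P = Matrix.scalar (Fin 1) (N : O)) (i : Fin g ⊕ Fin g) :
    lvl'.σ i ≫ serreTranslateInv act E' hE' Q = lvl.σ i ^ N :=
  LevelStructure.σ_comp_eq_pow_of_σ_eq_comp h (serreTranslate_comp_serreTranslateInv act E' hE' P Q hP hQ hQP) i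

end Serre

end AbelianSchemeOver

end Literature.AlgebraicGeometry.AbelianSchemes

end
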